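import Literature.Geometry.Kaehler.LelongTransversality
import Literature.Geometry.Kaehler.LelongLocalCover
import Literature.Geometry.Kaehler.LelongGraph
import Literature.Geometry.Kaehler.LelongGoodPart
import HarnessLib

/-!
# Lelong's theorem in the model space: the volume of the regular part over one chart

The core step of our proof of Lelong's theorem ([Chirka1989, §14.1 Thm.],
`Literature/Geometry/Kaehler/HolomorphicChainFacts.lean`) in a finite-dimensional complex normed
space `E` of dimension `n = p + (m + 1)`: for an analytic set `A ∋ a` all of whose regular points
near `a` have codimension `≥ m + 1` ("`dim_a A ≤ p`"),
`Literature.Geometry.Kaehler.SCV.exists_nhds_good_lt_top` produces an open `V ∋ a`, linear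
coordinates `Θ : E ≃ K × ℂ^{m+1}` (`dim K = p`) of a local analytic cover of `A` over a polydisc
(`exists_adapted_cover`) with its fibre bound and discriminant `Δ ≢ 0`, such that the part of
`A ∩ V` over `{Δ ≠ 0}` — which consists of regular points of dimension `p` — has
**finite `𝓗^{2p}`-measure**. Ingredients: the uniformly coercive family of proper projections
`ℓ_j` (`exists_finset_isolating_coercive`, replacing the unitary coordinates and Wirtinger's
theorem of the printed proof), the local covers along their kernels with the sheet-number
bounds `Kb_j` (`exists_adapted_cover`), the Lipschitz sections at regular points
(`exists_lipschitz_section`) and the counting argument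
(`hausdorffMeasure_lt_top_of_lipschitz_sections`). The complementary part over `{Δ = 0}` is an
analytic set of dimension `≤ p - 1` (`finrank_lt_of_isRegPt_of_discriminant`) and is handled by
induction on `p` in `Literature/Geometry/Kaehler/LelongModel.lean`.

## References

* E. M. Chirka, *Complex Analytic Sets*, Kluwer 1989, §3.4 Lemma 2, §3.7, §14.1 Thm.
  [Chirka1989].
-/

open scoped ENNReal NNReal Topology
open Metric Set Filter Function MeasureTheory MeasureTheory.Measure

namespace Literature.Geometry.Kaehler

namespace SCV

open Literature.Analysis.Complex.SCV

variable {E : Type*} [NormedAddCommGroup E] [NormedSpace ℂ E] [FiniteDimensional ℂ E]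

/-- A finite-dimensional space has subspaces of every dimension `p ≤ dim E`. [folklore] -/
theorem exists_submodule_finrank_eq {p : ℕ} (hp : p ≤ Module.finrank ℂ E) :
    ∃ T : Submodule ℂ E, Module.finrank ℂ T = p := by
  set b := Module.finBasis ℂ E
  set v : Fin p → E := fun i => b (Fin.castLE hp i) with hv
  have hli : LinearIndependent ℂ v := b.linearIndependent.comp _ (Fin.castLE_injective hp)
  refine ⟨Submodule.span ℂ (Set.range v), ?_⟩
  rw [finrank_span_eq_card hli, Fintype.card_fin]

omit [FiniteDimensional ℂ E] in
/-- Reparametrising an isolating plane by a linear isomorphism of the parameter space keeps it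
injective and isolating, with the same range. [folklore] -/
theorem isolating_comp_equiv {k₁ k₂ : ℕ} {A : Set E} {a : E} (ι : (Fin k₁ → ℂ) →L[ℂ] E)
    (e : (Fin k₂ → ℂ) ≃L[ℂ] (Fin k₁ → ℂ)) (hι : Injective ι)
    (hiso : ∀ᶠ w in 𝓝[≠] (0 : Fin k₁ → ℂ), a + ι w ∉ A) :
    Injective (ι.comp (e : (Fin k₂ → ℂ) →L[ℂ] (Fin k₁ → ℂ))) ∧
      (∀ᶠ w in 𝓝[≠] (0 : Fin k₂ → ℂ), a + ι.comp (e : (Fin k₂ → ℂ) →L[ℂ] (Fin k₁ → ℂ)) w ∉ A) ∧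
      LinearMap.range (ι.comp (e : (Fin k₂ → ℂ) →L[ℂ] (Fin k₁ → ℂ)) : (Fin k₂ → ℂ) →ₗ[ℂ] E) =
        LinearMap.range (ι : (Fin k₁ → ℂ) →ₗ[ℂ] E) := by
  refine ⟨hι.comp e.injective, ?_, ?_⟩
  · have ht : Tendsto (e : (Fin k₂ → ℂ) → (Fin k₁ → ℂ)) (𝓝[≠] 0) (𝓝[≠] 0) := by
      refine tendsto_nhdsWithin_of_tendsto_nhds_of_eventually_within _ ?_ ?_
      · have := e.continuous.tendsto (0 : Fin k₂ → ℂ)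
        rw [map_zero] at this
        exact this.mono_left nhdsWithin_le_nhds
      · refine eventually_nhdsWithin_of_forall fun w hw h0 => hw ?_
        exact e.injective (h0.trans (map_zero e).symm)
    exact ht.eventually hiso
  · ext x
    simp only [LinearMap.mem_range, ContinuousLinearMap.coe_coe, ContinuousLinearMap.coe_comp,
      ContinuousLinearEquiv.coe_coe, Function.comp_apply]
    constructor
    · rintro ⟨w, rfl⟩; exact ⟨e w, rfl⟩
    · rintro ⟨w, rfl⟩; exact ⟨e.symm w, by simp⟩

variable [MeasurableSpace E] [BorelSpace E]

/-- **The regular part of an analytic set over one local cover has finite `𝓗^{2p}`-measure**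
(the core of [Chirka1989, §14.1 Thm.]). Let `dim E = p + (m + 1)`, let `A ∋ a` be cut out by
holomorphic equations near `a`, all regular points of `A` near `a` of codimension `≥ m + 1`. Then
there are an open `V ∋ a` and linear coordinates `Θ : E ≃ K × ℂ^{m+1}`, `dim K = p`, radii
`ε, r`, a bound `Kb` and a function `Δ` on `K` with: `V` lies in the tube
`{(Θ x).1 ∈ B((Θ a).1, ε), (Θ x).2 ∈ B((Θ a).2, r)}`; every finite set of points of `A` over one
base point `z' ∈ B((Θ a).1, ε)` with fibre coordinate in `B̄((Θ a).2, r)` has at most `Kb`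
elements; `Δ` is holomorphic on `B((Θ a).1, ε)` and vanishes identically near none of its
points; and **`𝓗^{2p} {x ∈ A ∩ V | Δ (Θ x).1 ≠ 0} < ∞`**. [cite: Chirka1989, §14.1 Thm., p. 174] -/
theorem exists_nhds_good_lt_top {p m : ℕ} (hmn : Module.finrank ℂ E = p + (m + 1)) {A : Set E}
    {a : E} (hA : IsZeroSetAt A a) (haA : a ∈ A)
    (hdim : ∀ᶠ x in 𝓝 a, x ∈ A → ∀ q, IsRegPt A q x → Module.finrank ℂ E ≤ q + p) :
    ∃ (V : Set E) (K : Submodule ℂ E) (Θ : E ≃L[ℂ] (K × (Fin (m + 1) → ℂ))) (ε r : ℝ) (Kb : ℕ)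
      (Δ : K → ℂ), IsOpen V ∧ a ∈ V ∧ Module.finrank ℂ K = p ∧
      (∀ x ∈ V, (Θ x).1 ∈ ball (Θ a).1 ε ∧ (Θ x).2 ∈ ball (Θ a).2 r) ∧
      (∀ z' ∈ ball (Θ a).1 ε, ∀ F : Finset E,
        (∀ x ∈ F, x ∈ A ∧ (Θ x).1 = z' ∧ (Θ x).2 ∈ closedBall (Θ a).2 r) → F.card ≤ Kb) ∧
      DifferentiableOn ℂ Δ (ball (Θ a).1 ε) ∧ (∀ z' ∈ ball (Θ a).1 ε, ¬ Δ =ᶠ[𝓝 z'] 0) ∧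
      μH[2 * p] {x | x ∈ A ∩ V ∧ Δ (Θ x).1 ≠ 0} < ∞ := by
  classical
  set n := Module.finrank ℂ E with hn
  have hpn : p ≤ Module.finrank ℂ E := by omega
  have hnp : Module.finrank ℂ E - p = m + 1 := by omega
  -- (i) uniformly coercive isolating projections
  obtain ⟨k, ι, ℓ, c₀, hc₀, hιℓ, hcoer⟩ := exists_finset_isolating_coercive hA haA hdim hpn
  -- (ii) reparametrise the isolating planes by `Fin (m + 1)`
  set e : (Fin (m + 1) → ℂ) ≃L[ℂ] (Fin (Module.finrank ℂ E - p) → ℂ) :=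
    (LinearEquiv.funCongrLeft ℂ ℂ (finCongr hnp)).toContinuousLinearEquiv with he
  set ι' : Fin k → (Fin (m + 1) → ℂ) →L[ℂ] E := fun j =>
    (ι j).comp (e : (Fin (m + 1) → ℂ) →L[ℂ] (Fin (Module.finrank ℂ E - p) → ℂ)) with hι'
  have hι'p : ∀ j, Injective (ι' j) ∧ (∀ᶠ w in 𝓝[≠] (0 : Fin (m + 1) → ℂ), a + ι' j w ∉ A) ∧
      LinearMap.range (ι' j : (Fin (m + 1) → ℂ) →ₗ[ℂ] E) =
        LinearMap.range (ι j : (Fin (Module.finrank ℂ E - p) → ℂ) →ₗ[ℂ] E) := fun j =>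
    isolating_comp_equiv (ι j) e (hιℓ j).1 (hιℓ j).2.1
  -- (iii) the local covers along the isolating planes
  choose K Θ ε r Kb Δ hΘι hε hr _hzero hfib hΔd hΔne hreg using fun j =>
    exists_adapted_cover hA (ι' j) (hι'p j).1 (hι'p j).2.1
  have hdimK : ∀ j, Module.finrank ℂ (K j) = p := fun j => by
    have h1 := (Θ j).toLinearEquiv.finrank_eq
    rw [Module.finrank_prod, Module.finrank_fin_fun] at h1
    omega
  -- (iv) a distinguished index
  obtain ⟨T₀, hT₀⟩ := exists_submodule_finrank_eq (E := E) hpn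
  obtain ⟨j₀, -⟩ := hcoer T₀ hT₀
  -- (v) the neighbourhood `V`
  obtain ⟨UA, hUAo, haUA, _, gA, hgA, hAUA⟩ := hA
  set tube : Fin k → Set E := fun j =>
    {x | (Θ j x).1 ∈ ball (Θ j a).1 (ε j) ∧ (Θ j x).2 ∈ ball (Θ j a).2 (r j)} with htube
  have htubeo : ∀ j, IsOpen (tube j) := fun j =>
    (isOpen_ball.preimage (continuous_fst.comp (Θ j).continuous)).inter
      (isOpen_ball.preimage (continuous_snd.comp (Θ j).continuous))
  have hatube : ∀ j, a ∈ tube j := fun j => ⟨mem_ball_self (hε j), mem_ball_self (hr j)⟩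
  set V : Set E := UA ∩ (⋂ j, tube j) ∩ ball a 1 with hV
  have hVo : IsOpen V :=
    (hUAo.inter (isOpen_iInter_of_finite htubeo)).inter isOpen_ball
  have haV : a ∈ V := ⟨⟨haUA, mem_iInter.2 hatube⟩, mem_ball_self one_pos⟩
  have hVtube : ∀ j, ∀ x ∈ V, x ∈ tube j := fun j x hx => mem_iInter.1 hx.1.2 j
  have hVb : Bornology.IsBounded V := isBounded_ball.subset fun x hx => hx.2
  have hAVm : MeasurableSet (A ∩ V) := by
    have h1 : A ∩ V = (UA ∩ gA ⁻¹' {0}) ∩ V := by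
      ext x
      constructor
      · rintro ⟨hxA, hxV⟩
        exact ⟨hAUA.subset ⟨hxA, hxV.1.1⟩, hxV⟩
      · rintro ⟨hx, hxV⟩
        exact ⟨(hAUA.symm.subset hx).1, hxV⟩
    have h2 : IsOpen (UA ∩ gA ⁻¹' {0}ᶜ) :=
      hgA.continuousOn.isOpen_inter_preimage hUAo isOpen_compl_singleton
    have h3 : UA ∩ gA ⁻¹' {0} = UA \ (UA ∩ gA ⁻¹' {0}ᶜ) := by
      ext x; constructor
      · rintro ⟨hxU, hx0⟩; exact ⟨hxU, fun h => h.2 hx0⟩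
      · rintro ⟨hxU, hx⟩; exact ⟨hxU, by_contra fun h0 => hx ⟨hxU, h0⟩⟩
    rw [h1, h3]
    exact (hUAo.measurableSet.diff h2.measurableSet).inter hVo.measurableSet
  -- (vi) the good set
  set G : Set E := {x | x ∈ A ∩ V ∧ Δ j₀ (Θ j₀ x).1 ≠ 0} with hG
  have hGm : MeasurableSet G := by
    have hO : IsOpen (ball (Θ j₀ a).1 (ε j₀) ∩ Δ j₀ ⁻¹' {0}ᶜ) :=
      (hΔd j₀).continuousOn.isOpen_inter_preimage isOpen_ball isOpen_compl_singleton
    have hO' : IsOpen ((fun x : E => (Θ j₀ x).1) ⁻¹' (ball (Θ j₀ a).1 (ε j₀) ∩ Δ j₀ ⁻¹' {0}ᶜ)) :=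
      hO.preimage (continuous_fst.comp (Θ j₀).continuous)
    have hGeq : G = (A ∩ V) ∩
        (fun x : E => (Θ j₀ x).1) ⁻¹' (ball (Θ j₀ a).1 (ε j₀) ∩ Δ j₀ ⁻¹' {0}ᶜ) := by
      ext x
      constructor
      · rintro ⟨hxAV, hΔx⟩
        exact ⟨hxAV, (hVtube j₀ x hxAV.2).1, hΔx⟩
      · rintro ⟨hxAV, -, hΔx⟩
        exact ⟨hxAV, hΔx⟩
    rw [hGeq]
    exact hAVm.inter hO'.measurableSet
  have hGb : Bornology.IsBounded G := hVb.subset fun x hx => hx.1.2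
  -- (vii) bounded multiplicity of the projections `ℓ j` on `G`
  have hfibG : ∀ j y, ∀ F : Finset E, (∀ x ∈ F, x ∈ G ∧ ℓ j x = y) → F.card ≤ Kb j := by
    intro j y F hF
    rcases F.eq_empty_or_nonempty with hFe | ⟨x₀, hx₀⟩
    · simp [hFe]
    obtain ⟨⟨⟨-, hx₀V⟩, -⟩, hx₀y⟩ := hF x₀ hx₀
    refine hfib j (Θ j x₀).1 (hVtube j x₀ hx₀V).1 F fun x hx => ?_
    obtain ⟨⟨⟨hxA, hxV⟩, -⟩, hxy⟩ := hF x hx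
    have hker : x - x₀ ∈ LinearMap.ker (ℓ j : E →ₗ[ℂ] (Fin p → ℂ)) := by
      rw [LinearMap.mem_ker, ContinuousLinearMap.coe_coe, map_sub, hxy, hx₀y, sub_self]
    rw [(hιℓ j).2.2.2, ← (hι'p j).2.2] at hker
    obtain ⟨w, hw⟩ := hker
    have hw' : ι' j w = x - x₀ := hw
    have hΘx : Θ j x = Θ j x₀ + (0, w) := by
      rw [← hΘι j w, ← map_add, hw', add_sub_cancel]
    refine ⟨hxA, ?_, ball_subset_closedBall (hVtube j x hxV).2⟩
    rw [hΘx, Prod.fst_add, add_eq_left]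
  -- (viii) Lipschitz sections at the points of `G`
  have hlocG : ∀ x ∈ G, ∃ (j : Fin k) (W : Set E) (D : Set (Fin p → ℂ)) (s : (Fin p → ℂ) → E),
      IsOpen W ∧ x ∈ W ∧ MapsTo (ℓ j) W D ∧
        LipschitzOnWith (Real.toNNReal (c₀⁻¹ + 1)) s D ∧ ∀ z ∈ G ∩ W, s (ℓ j z) = z := by
    intro x hx
    obtain ⟨⟨hxA, hxV⟩, hΔx⟩ := hx
    obtain ⟨U, hU, hxU, g, hg, hAU, hsurj⟩ :=
      hreg j₀ x hxA (hVtube j₀ x hxV).1 (hVtube j₀ x hxV).2 hΔx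
    set T : Submodule ℂ E := LinearMap.ker (fderiv ℂ g x : E →ₗ[ℂ] (Fin (m + 1) → ℂ)) with hT
    have hTdim : Module.finrank ℂ T = p := by
      have h1 := finrank_ker_of_surjective (fderiv ℂ g x : E →ₗ[ℂ] (Fin (m + 1) → ℂ)) hsurj
      change Module.finrank ℂ T + (m + 1) = Module.finrank ℂ E at h1
      omega
    obtain ⟨j, hj⟩ := hcoer T hTdim
    obtain ⟨W, D, s, hWo, hxW, hmaps, hlip, hsec⟩ :=
      exists_lipschitz_section hU hxU hg hAU hxA hsurj (ℓ j) hc₀ hj hTdim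
    exact ⟨j, W, D, s, hWo, hxW, hmaps, hlip, fun z hz => hsec z ⟨hz.1.1.1, hz.2⟩⟩
  -- (ix) the estimate
  have hgood : μH[2 * p] G < ∞ :=
    hausdorffMeasure_lt_top_of_lipschitz_sections hGm hGb ℓ _ Kb hfibG hlocG
  exact ⟨V, K j₀, Θ j₀, ε j₀, r j₀, Kb j₀, Δ j₀, hVo, haV, hdimK j₀, hVtube j₀, hfib j₀, hΔd j₀,
    hΔne j₀, hgood⟩

end SCV

end Literature.Geometry.Kaehler
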